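import Summits.BirchSwinnertonDyer.BirchSwinnertonDyer.Theorems.ResidualThetaTransportAtTwoThetaLayerLambdaCongruenceAtTwoCuspSpanFunctionalNeg
import Summits.BirchSwinnertonDyer.BirchSwinnertonDyer.Theorems.ResidualThetaTransportAtTwoThetaLayerLambdaCongruenceAtTwoCuspSpanEllipticFamilies
import HarnessLib

/-!
# Route `ResidualThetaTransportAtTwo`, cruxes Kan⁺ (stmt-BirchSwinnertonDyer-20688) / node 27436 / 21437: PROPAGATION CERTIFICATES — the node at a
# small-`⟨4⟩` prime from a coset-indexed table of realised pairs and at most two rounds of coboundary propagation (all checks `decide`)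

Cell `bsd-wall`, width seat `bsd-wall-rtt-p3-w5` g2 (2026-08-28). THEOREMS ONLY; `--supports stmt-BirchSwinnertonDyer-20688`; BSD is not proved by
this. Complements the uniform theorems (`…CuspSpanJacobi`, `…CuspSpanJacobiMoment`): those cover every odd prime with `p ≳ 3 n³`
(`n = [𝔽ₚˣ : ⟨4,−1⟩]`); the residue is the sparse set of small-`⟨4⟩` primes, where the cocycle closure of the realised coset pairs still fills
everything (seat numerics, every prime tested, ≤ 2 rounds). This file turns that observation into a CERTIFICATE FORMAT checked by `decide`:

DATA at a prime `p`: a primitive root `g`, the index `n`, a sign/exponent with `gⁿ = ±4^{k₀}` (so the cosets of `H = ⟨4,−1⟩` are `gⁱH`,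
`i < n`), a table `W` of realisation witnesses (`gⁱ·(±4^{k₁}) + gⁱ gʲ·(±4^{k₂}) = 1` for the pairs `(i, j)` marked in `R₀`) and a Boolean table `T₁`
(the pairs obtained in round 1). CHECKS: `hW` (witnesses), `hT₁` (every round-1 pair has a pivot `ℓ` with `(i,ℓ)`, `(i+ℓ, j−ℓ)`, `(ℓ, j−ℓ)` realised),
`hfin` (every pair is in `T₁` or has a pivot among `T₁`-pairs) — indices mod `n`, because `gⁱgˡ ∈ g^{i+ℓ}H` and `gʲ/gˡ ∈ g^{j−ℓ}H`.

THEOREM `cuspSpanEvenAtTwo_of_propagationCert`: such data ⟹ `CuspSpanEvenAtTwo p`. PROOF: for an `H`-invariant `F` with Manin's rule,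
`P(x, y) :⟺ F(xy) = F(x) + F(y)` holds on realised pairs (`…CuspSpanCosetPropagation` idea, redone for field elements), is transported along `H`
in both slots, and propagates by the 2-cocycle identity `P(a,b) ∧ P(ab,c) ∧ P(b,c) ⟹ P(a,bc)`; two rounds give `P(gⁱ, gʲ)` for all `i, j`, and every
unit is `gᵗ = gⁱ·(gⁿ)^s ∈ gⁱH`. Then Theorem C⁻(p) (`…CuspSpanFunctionalNeg`). Instances: `…CuspSpanPropagationCertLevels`.

References: Ju. I. Manin, Izv. 36 (1972) §1.5 [Manin1972]; [Pollack2003] Conj. 6.3.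
-/

set_option autoImplicit false
set_option linter.dupNamespace false

open scoped MatrixGroups

open CongruenceSubgroup

namespace Summit.BirchSwinnertonDyer.BirchSwinnertonDyer.Theorems.SignedMuAtTwo

section WithFact

variable {p : ℕ} [Fact p.Prime]

/-- `orderOf g = p − 1` from a finite check (`g^{p−1} = 1`, `g^{(p−1)/q} ≠ 1` for the primes `q ∣ p − 1`). [folklore] -/
theorem orderOf_eq_card_sub_one_of_check {g : ZMod p} (hpow : g ^ (p - 1) = 1)
    (hd : ∀ q ∈ (p - 1).primeFactors, g ^ ((p - 1) / q) ≠ 1) : orderOf g = p - 1 := by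
  have hp1 : 0 < p - 1 := by have := (Fact.out : p.Prime).two_le; omega
  exact orderOf_eq_of_pow_and_pow_div_prime hp1 hpow fun q hq hqm ↦ hd q (Nat.mem_primeFactors.mpr ⟨hq, hqm, hp1.ne'⟩)

/-- **Propagation certificate ⟹ node.** See the module docstring for the data and the checks. [cite: Pollack2003, Conj. 6.3]
[cite: Manin1972, §1.5] -/
theorem cuspSpanEvenAtTwo_of_propagationCert (hp2 : p ≠ 2) {n : ℕ} [NeZero n] (g : ZMod p) (hg : orderOf g = p - 1)
    (s₀ : Bool) (k₀ : ℕ) (hgn : g ^ n = (if s₀ then -1 else 1) * 4 ^ k₀)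
    (R₀ T₁ : Fin n → Fin n → Bool) (W : Fin n → Fin n → ℕ × Bool × ℕ × Bool)
    (hW : ∀ i j : Fin n, R₀ i j = true →
      g ^ (i : ℕ) * ((if (W i j).2.1 then -1 else 1) * 4 ^ (W i j).1) +
        g ^ (i : ℕ) * g ^ (j : ℕ) * ((if (W i j).2.2.2 then -1 else 1) * 4 ^ (W i j).2.2.1) = 1)
    (hT₁ : ∀ i j : Fin n, T₁ i j = true →
      R₀ i j = true ∨ ∃ ℓ : Fin n, R₀ i ℓ = true ∧ R₀ (i + ℓ) (j - ℓ) = true ∧ R₀ ℓ (j - ℓ) = true)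
    (hfin : ∀ i j : Fin n, T₁ i j = true ∨ ∃ ℓ : Fin n, T₁ i ℓ = true ∧ T₁ (i + ℓ) (j - ℓ) = true ∧ T₁ ℓ (j - ℓ) = true) :
    CuspSpanEvenAtTwo p := by
  have hp : p.Prime := Fact.out
  have h40 : (4 : ZMod p) ≠ 0 := by
    intro h0
    have h0' : ((4 : ℕ) : ZMod p) = 0 := by exact_mod_cast h0
    have h4' : p ∣ 2 ^ 2 := by norm_num; exact (ZMod.natCast_eq_zero_iff 4 p).mp h0'
    exact hp2 ((Nat.prime_dvd_prime_iff_eq hp Nat.prime_two).mp (hp.dvd_of_dvd_pow h4'))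
  have hg0 : g ≠ 0 := by
    rintro rfl
    rw [orderOf_eq_zero_iff'.mpr (fun n hn ↦ by rw [zero_pow hn.ne']; exact zero_ne_one)] at hg
    have := hp.two_le; omega
  have hnpos : 0 < n := Nat.pos_of_ne_zero (NeZero.ne n)
  refine cuspSpanEvenAtTwo_of_functional_criterion_neg hp2 fun F _ h4 _ _ h5 _ h7 _ ↦ ?_
  -- `H`-invariance: `F (c y) = F y` for `c = ±4^K`
  have h4K : ∀ (K : ℕ) (y : ZMod p), y ≠ 0 → F (4 ^ K * y) = F y := by
    intro K
    induction K with
    | zero => intro y _; rw [pow_zero, one_mul]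
    | succ K ih => intro y hy; rw [pow_succ, mul_comm (4 ^ K) 4, mul_assoc, h4 _ (mul_ne_zero (pow_ne_zero _ h40) hy), ih y hy]
  have hH : ∀ c : ZMod p, (∃ K : ℕ, c = 4 ^ K ∨ c = -(4 ^ K)) → ∀ y : ZMod p, y ≠ 0 → F (c * y) = F y := by
    rintro c ⟨K, hc | hc⟩ y hy
    · rw [hc, h4K K y hy]
    · rw [hc, neg_mul, h7 _ (mul_ne_zero (pow_ne_zero _ h40) hy), h4K K y hy]
  -- the set `{±4^K}` is closed under products, powers and inverses, and contains `gⁿ`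
  have hHmul : ∀ c d : ZMod p, (∃ K : ℕ, c = 4 ^ K ∨ c = -(4 ^ K)) → (∃ K : ℕ, d = 4 ^ K ∨ d = -(4 ^ K)) →
      ∃ K : ℕ, c * d = 4 ^ K ∨ c * d = -(4 ^ K) := by
    rintro c d ⟨i, hi⟩ ⟨j, hj⟩
    refine ⟨i + j, ?_⟩
    rw [pow_add]
    rcases hi with hi | hi <;> rcases hj with hj | hj <;> rw [hi, hj]
    · left; ring
    · right; ring
    · right; ring
    · left; ring
  have hHpow : ∀ (c : ZMod p) (q : ℕ), (∃ K : ℕ, c = 4 ^ K ∨ c = -(4 ^ K)) → ∃ K : ℕ, c ^ q = 4 ^ K ∨ c ^ q = -(4 ^ K) := by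
    intro c q hc
    induction q with
    | zero => exact ⟨0, Or.inl (by rw [pow_zero, pow_zero])⟩
    | succ q ih => rw [pow_succ]; exact hHmul _ _ ih hc
  have hHinv : ∀ c : ZMod p, (∃ K : ℕ, c = 4 ^ K ∨ c = -(4 ^ K)) → ∃ K : ℕ, c⁻¹ = 4 ^ K ∨ c⁻¹ = -(4 ^ K) := by
    rintro c ⟨i, hi⟩
    refine ⟨i * (p - 2), ?_⟩
    have h4i : (4 : ZMod p) ^ i * 4 ^ (i * (p - 2)) = 1 := by
      have hp1 : p - 2 + 1 = p - 1 := by have := hp.two_le; omega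
      rw [← pow_add, show i + i * (p - 2) = (p - 1) * i by rw [← hp1]; ring, pow_mul, ZMod.pow_card_sub_one_eq_one h40, one_pow]
    rcases hi with hi | hi <;> rw [hi]
    · left; exact inv_eq_of_mul_eq_one_right h4i
    · right; rw [inv_neg]; exact congrArg Neg.neg (inv_eq_of_mul_eq_one_right h4i)
  have hHne : ∀ c : ZMod p, (∃ K : ℕ, c = 4 ^ K ∨ c = -(4 ^ K)) → c ≠ 0 := by
    rintro c ⟨K, hc | hc⟩
    · rw [hc]; exact pow_ne_zero _ h40
    · rw [hc]; exact neg_ne_zero.mpr (pow_ne_zero _ h40)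
  have hgnH : ∃ K : ℕ, g ^ n = 4 ^ K ∨ g ^ n = -(4 ^ K) := by
    refine ⟨k₀, ?_⟩
    rw [hgn]
    cases s₀
    · left; simp
    · right; simp
  -- `P x y := F (x y) = F x + F y`; transport along `H`
  have hP_transport : ∀ (c d x y : ZMod p), (∃ K : ℕ, c = 4 ^ K ∨ c = -(4 ^ K)) → (∃ K : ℕ, d = 4 ^ K ∨ d = -(4 ^ K)) →
      x ≠ 0 → y ≠ 0 → F (x * y) = F x + F y → F (c * x * (d * y)) = F (c * x) + F (d * y) := by
    intro c d x y hc hd hx hy hPxy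
    rw [show c * x * (d * y) = (c * d) * (x * y) by ring, hH _ (hHmul c d hc hd) _ (mul_ne_zero hx hy), hH c hc x hx,
      hH d hd y hy, hPxy]
  -- realised pair ⟹ `P`
  have hP_real : ∀ (x y : ZMod p) (k₁ : ℕ) (b₁ : Bool) (k₂ : ℕ) (b₂ : Bool), x ≠ 0 → y ≠ 0 →
      x * ((if b₁ then -1 else 1) * 4 ^ k₁) + x * y * ((if b₂ then -1 else 1) * 4 ^ k₂) = 1 → F (x * y) = F x + F y := by
    intro x y k₁ b₁ k₂ b₂ hx hy hsum
    have hc₁ : ∃ K : ℕ, ((if b₁ then -1 else 1) * 4 ^ k₁ : ZMod p) = 4 ^ K ∨ ((if b₁ then -1 else 1) * 4 ^ k₁ : ZMod p) = -(4 ^ K) :=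
      ⟨k₁, by cases b₁ <;> simp⟩
    have hc₂ : ∃ K : ℕ, ((if b₂ then -1 else 1) * 4 ^ k₂ : ZMod p) = 4 ^ K ∨ ((if b₂ then -1 else 1) * 4 ^ k₂ : ZMod p) = -(4 ^ K) :=
      ⟨k₂, by cases b₂ <;> simp⟩
    set c₁ : ZMod p := (if b₁ then -1 else 1) * 4 ^ k₁ with hc₁def
    set c₂ : ZMod p := (if b₂ then -1 else 1) * 4 ^ k₂ with hc₂def
    set u : ZMod p := x * c₁ with hu
    have hu0 : u ≠ 0 := mul_ne_zero hx (hHne c₁ hc₁)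
    have hu1 : u - 1 = -(x * y * c₂) := by rw [hu]; linear_combination hsum
    have hu10 : u - 1 ≠ 0 := by rw [hu1]; exact neg_ne_zero.mpr (mul_ne_zero (mul_ne_zero hx hy) (hHne c₂ hc₂))
    have e1 : F u = F x := by rw [hu, mul_comm, hH c₁ hc₁ x hx]
    have e2 : F (u - 1) = F (x * y) := by
      rw [hu1, h7 _ (mul_ne_zero (mul_ne_zero hx hy) (hHne c₂ hc₂)), mul_comm, hH c₂ hc₂ _ (mul_ne_zero hx hy)]
    have e3 : F ((u - 1) * u⁻¹) = F y := by
      have e : (u - 1) * u⁻¹ = -(c₂ * c₁⁻¹) * y := by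
        rw [hu1, hu]; field_simp [hHne c₁ hc₁]
      obtain ⟨K, hK⟩ := hHmul _ _ hc₂ (hHinv c₁ hc₁)
      have hneg : ∃ K' : ℕ, -(c₂ * c₁⁻¹) = 4 ^ K' ∨ -(c₂ * c₁⁻¹) = -(4 ^ K') := by
        refine ⟨K, ?_⟩
        rcases hK with hK | hK <;> rw [hK]
        · right; rfl
        · left; rw [neg_neg]
      rw [e, hH _ hneg y hy]
    have h := h5 u hu0 hu10
    rw [e1, e2, e3] at h
    have e : F (x * y) = -(F x + F y) := by linear_combination h
    rw [e, ZMod.neg_eq_self_mod_two]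
  -- cocycle
  have hP_cocycle : ∀ a b c : ZMod p, F (a * b) = F a + F b → F (a * b * c) = F (a * b) + F c → F (b * c) = F b + F c →
      F (a * (b * c)) = F a + F (b * c) := by
    intro a b c h1 h2 h3
    rw [← mul_assoc, h2, h1, h3]
    ring
  -- the coset representatives `ρ i := gⁱ` and their index arithmetic
  have hρ0 : ∀ i : Fin n, g ^ (i : ℕ) ≠ 0 := fun i ↦ pow_ne_zero _ hg0
  have hρ_add : ∀ i ℓ : Fin n, ∃ c : ZMod p, (∃ K : ℕ, c = 4 ^ K ∨ c = -(4 ^ K)) ∧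
      g ^ (i : ℕ) * g ^ (ℓ : ℕ) = c * g ^ ((i + ℓ : Fin n) : ℕ) := by
    intro i ℓ
    refine ⟨(g ^ n) ^ (((i : ℕ) + ℓ) / n), hHpow _ _ hgnH, ?_⟩
    rw [Fin.val_add, ← pow_add, ← pow_mul, ← pow_add]
    congr 1
    have := Nat.div_add_mod ((i : ℕ) + ℓ) n
    linarith
  have hρ_sub : ∀ j ℓ : Fin n, ∃ d : ZMod p, (∃ K : ℕ, d = 4 ^ K ∨ d = -(4 ^ K)) ∧
      g ^ (j : ℕ) * (g ^ (ℓ : ℕ))⁻¹ = d * g ^ ((j - ℓ : Fin n) : ℕ) := by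
    intro j ℓ
    -- `(j − ℓ).val + ℓ.val = j.val + n·c`
    have hval : ((j - ℓ : Fin n) : ℕ) = (n - (ℓ : ℕ) + j) % n := by rw [Fin.sub_def]
    have hℓ : (ℓ : ℕ) < n := ℓ.isLt
    have hj : (j : ℕ) < n := j.isLt
    obtain ⟨c, hc⟩ : ∃ c : ℕ, ((j - ℓ : Fin n) : ℕ) + ℓ = j + n * c := by
      rw [hval]
      by_cases h : (ℓ : ℕ) ≤ j
      · refine ⟨0, ?_⟩
        rw [show n - (ℓ : ℕ) + j = (j - ℓ) + n by omega, Nat.add_mod_right, Nat.mod_eq_of_lt (by omega)]; omega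
      · refine ⟨1, ?_⟩
        rw [Nat.mod_eq_of_lt (by omega)]; omega
    obtain ⟨d, hd⟩ := hHinv _ (hHpow _ c hgnH)
    refine ⟨((g ^ n) ^ c)⁻¹, ⟨d, hd⟩, ?_⟩
    have e : g ^ ((j - ℓ : Fin n) : ℕ) * g ^ (ℓ : ℕ) = g ^ (j : ℕ) * (g ^ n) ^ c := by
      rw [← pow_add, hc, pow_add, pow_mul]
    have hgℓ : g ^ (ℓ : ℕ) ≠ 0 := pow_ne_zero _ hg0
    have hgnc : (g ^ n) ^ c ≠ 0 := pow_ne_zero _ (pow_ne_zero _ hg0)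
    rw [mul_inv_eq_iff_eq_mul₀ hgℓ, mul_assoc, eq_inv_mul_iff_mul_eq₀ hgnc, e]
    ring
  -- `P` on representative pairs
  have hPidx_of_R : ∀ i j : Fin n, R₀ i j = true → F (g ^ (i : ℕ) * g ^ (j : ℕ)) = F (g ^ (i : ℕ)) + F (g ^ (j : ℕ)) := by
    intro i j hij
    exact hP_real _ _ (W i j).1 (W i j).2.1 (W i j).2.2.1 (W i j).2.2.2 (hρ0 i) (hρ0 j) (hW i j hij)
  have hPivot : ∀ (Q : Fin n → Fin n → Prop),
      (∀ i j, Q i j → F (g ^ (i : ℕ) * g ^ (j : ℕ)) = F (g ^ (i : ℕ)) + F (g ^ (j : ℕ))) →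
      ∀ i j ℓ : Fin n, Q i ℓ → Q (i + ℓ) (j - ℓ) → Q ℓ (j - ℓ) →
        F (g ^ (i : ℕ) * g ^ (j : ℕ)) = F (g ^ (i : ℕ)) + F (g ^ (j : ℕ)) := by
    intro Q hQ i j ℓ q1 q2 q3
    have p1 := hQ _ _ q1
    have p2 := hQ _ _ q2
    have p3 := hQ _ _ q3
    obtain ⟨c, hc, ec⟩ := hρ_add i ℓ
    obtain ⟨d, hd, ed⟩ := hρ_sub j ℓ
    -- transport `p2` to `(gⁱ gˡ, gʲ / gˡ)` and `p3` to `(gˡ, gʲ/gˡ)`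
    have hx0 : g ^ ((i + ℓ : Fin n) : ℕ) ≠ 0 := hρ0 _
    have hy0 : g ^ ((j - ℓ : Fin n) : ℕ) ≠ 0 := hρ0 _
    have p2' := hP_transport c d _ _ hc hd hx0 hy0 p2
    rw [← ec, ← ed] at p2'
    have p3' := hP_transport 1 d _ _ ⟨0, Or.inl (by rw [pow_zero])⟩ hd (hρ0 ℓ) hy0 p3
    rw [one_mul, ← ed] at p3'
    have h := hP_cocycle (g ^ (i : ℕ)) (g ^ (ℓ : ℕ)) (g ^ (j : ℕ) * (g ^ (ℓ : ℕ))⁻¹) p1 p2' p3'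
    have hs : g ^ (ℓ : ℕ) * (g ^ (j : ℕ) * (g ^ (ℓ : ℕ))⁻¹) = g ^ (j : ℕ) := by
      rw [mul_comm, mul_assoc, inv_mul_cancel₀ (hρ0 ℓ), mul_one]
    rw [hs] at h
    exact h
  have hPidx_of_T : ∀ i j : Fin n, T₁ i j = true → F (g ^ (i : ℕ) * g ^ (j : ℕ)) = F (g ^ (i : ℕ)) + F (g ^ (j : ℕ)) := by
    intro i j hij
    rcases hT₁ i j hij with h | ⟨ℓ, q1, q2, q3⟩
    · exact hPidx_of_R i j h
    · exact hPivot (fun a b ↦ R₀ a b = true) hPidx_of_R i j ℓ q1 q2 q3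
  have hPidx : ∀ i j : Fin n, F (g ^ (i : ℕ) * g ^ (j : ℕ)) = F (g ^ (i : ℕ)) + F (g ^ (j : ℕ)) := by
    intro i j
    rcases hfin i j with h | ⟨ℓ, q1, q2, q3⟩
    · exact hPidx_of_T i j h
    · exact hPivot (fun a b ↦ T₁ a b = true) hPidx_of_T i j ℓ q1 q2 q3
  -- every unit is `gᵗ ∈ g^{t mod n} H`
  have hdec : ∀ x : ZMod p, x ≠ 0 → ∃ i : Fin n, ∃ c : ZMod p, (∃ K : ℕ, c = 4 ^ K ∨ c = -(4 ^ K)) ∧ x = c * g ^ (i : ℕ) := by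
    intro x hx
    obtain ⟨t, rfl⟩ := exists_pow_eq_of_orderOf_eq hg hx
    refine ⟨⟨t % n, Nat.mod_lt _ hnpos⟩, (g ^ n) ^ (t / n), hHpow _ _ hgnH, ?_⟩
    rw [← pow_mul, ← pow_add]
    congr 1
    have := Nat.div_add_mod t n
    linarith
  intro x y hx hy
  obtain ⟨i, c, hc, rfl⟩ := hdec x hx
  obtain ⟨j, d, hd, rfl⟩ := hdec y hy
  exact hP_transport c d _ _ hc hd (hρ0 i) (hρ0 j) (hPidx i j)

end WithFact

/-- **Propagation certificate ⟹ node, bundled form for instances.** Primality, the primitive root and the three table checks are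
hypotheses of closed decidable shape, stated WITHOUT the `Fact p.Prime` instance in scope (so that they elaborate over the plain ring
structure of `ZMod p` and an instance discharges each by a closed `decide +kernel` / `norm_num`). [cite: Pollack2003, Conj. 6.3] -/
theorem cuspSpanEvenAtTwo_of_propagationCert' {p n : ℕ} [NeZero p] [NeZero n] (hp : p.Prime) (hp2 : p ≠ 2) (g : ZMod p)
    (hg1 : g ^ (p - 1) = 1) (hg2 : ∀ q ∈ (p - 1).primeFactors, g ^ ((p - 1) / q) ≠ 1)
    (s₀ : Bool) (k₀ : ℕ) (hgn : g ^ n = (if s₀ then -1 else 1) * 4 ^ k₀)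
    (R₀ T₁ : Fin n → Fin n → Bool) (W : Fin n → Fin n → ℕ × Bool × ℕ × Bool)
    (hc : (∀ i j : Fin n, R₀ i j = true →
        g ^ (i : ℕ) * ((if (W i j).2.1 then -1 else 1) * 4 ^ (W i j).1) +
          g ^ (i : ℕ) * g ^ (j : ℕ) * ((if (W i j).2.2.2 then -1 else 1) * 4 ^ (W i j).2.2.1) = 1) ∧
      (∀ i j : Fin n, T₁ i j = true →
        R₀ i j = true ∨ ∃ ℓ : Fin n, R₀ i ℓ = true ∧ R₀ (i + ℓ) (j - ℓ) = true ∧ R₀ ℓ (j - ℓ) = true) ∧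
      (∀ i j : Fin n, T₁ i j = true ∨ ∃ ℓ : Fin n, T₁ i ℓ = true ∧ T₁ (i + ℓ) (j - ℓ) = true ∧ T₁ ℓ (j - ℓ) = true)) :
    CuspSpanEvenAtTwo p := by
  haveI : Fact p.Prime := ⟨hp⟩
  exact cuspSpanEvenAtTwo_of_propagationCert hp2 g (orderOf_eq_card_sub_one_of_check hg1 hg2) s₀ k₀ hgn R₀ T₁ W
    hc.1 hc.2.1 hc.2.2

end Summit.BirchSwinnertonDyer.BirchSwinnertonDyer.Theorems.SignedMuAtTwo
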